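import Literature.NumberTheory.EllipticCurves.PadicPointsFiltration
import HarnessLib

/-!
# The limit logarithm on `E₁(ℚ_p)`: convergence, additivity, and `E⁽ⁿ⁾(ℚ_p) ≃+ ℤ_p` (`n ≥ 2`)

Trunk T-NT-EC (Literature/NumberTheory/EllipticCurves). Second of three files discharging the
named fact `Literature.NumberTheory.EllipticCurves.exists_finiteIndex_addEquiv_padicInt`
(Silverman, *AEC*, Prop. VII.6.3 for `K = ℚ_p`); proofs only, for an elliptic curve over `ℚ_p`
with `p`-integral equation, about the objects of `PadicPointsFiltration.lean`:
the subgroups `E⁽ⁿ⁾(ℚ_p) = W.formalFiltration n` (`= {P ∈ E₁(ℚ_p) : ‖z(P)‖ ≤ p⁻ⁿ}`; note that over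
`ℚ_p` the stages `0` and `1` coincide with `E₁(ℚ_p)`, since `‖z‖ < 1 ⇔ ‖z‖ ≤ p⁻¹`, so AEC's
`Ê(𝓜ⁿ)`, `n ≥ 1`, is matched verbatim from `n = 1` on) and the limit logarithm
`L(P) = W.padicLimitLog P = lim_k z(pᵏP)/pᵏ` — the object that stands in for the tree's
`WeierstrassCurve.padicLogPoint` (`log_W(z(P))`, behind the unproved `summable_formalLog` /
`padicLogPoint_add` of `FormalGroup.lean`); a later `padicLimitLog_eq_padicLogPoint` (under
`summable_formalLog`) would identify the two.

## Main statements (all `W` `p`-integral and elliptic)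

* `norm_formalParameter_nsmul_sub_le`: `‖z(jP) - j·z(P)‖ ≤ ‖z(P)‖²` on `E₁(ℚ_p)`;
  `norm_formalParameter_p_pow_nsmul`: `‖z(pᵏP)‖ = p⁻ᵏ‖z(P)‖` when `‖z(P)‖ < p⁻¹`.
* `tendsto_approx_padicLimitLog`: `z(pᵏP)/pᵏ → L(P)`; `norm_padicLimitLog`: `‖L(P)‖ = ‖z(P)‖`
  (`‖z(P)‖ < p⁻¹`); `padicLimitLog_add`: **`L(P + Q) = L(P) + L(Q)`** — from
  `pᵏ(P + Q) = pᵏP + pᵏQ` in the group and `z(A + B) = z(A) + z(B) + O(max²)`.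
* `norm_formalParameter_add_sub_le` (`‖z(Q + P) - z(Q)‖ ≤ ‖z(P)‖`) and
  `norm_formalParameter_sub_le` (`‖z(P - Q)‖ ≤ ‖z(P) - z(Q)‖`): translation and difference are
  `1`-Lipschitz in the parameter.
* `exists_mem_padicLimitLog_eq`: `L : E⁽ⁿ⁾ → pⁿℤ_p` is onto for `n ≥ 2` (successive
  approximation through the inverse dictionary), and
  **`nonempty_formalFiltration_addEquiv_padicInt`: `E⁽ⁿ⁾(ℚ_p) ≃+ ℤ_p` for every `n ≥ 2` and
  every prime `p`** (AEC IV.6.4(b): `Ê(𝓜ʳ) ≅ R⁺` for `r > v(p)/(p-1)`, here with the uniform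
  `r = 2` and the limit logarithm in place of `log_Ê`).

## Sources

* J. H. Silverman, *The Arithmetic of Elliptic Curves*, 2nd ed. (2009), IV.2.3 (`[m](T) = mT + ⋯`),
  IV.3.2, IV.6.4(b), VII.2.2, VII.6.3 (`SilvermanAEC2009`).
-/

noncomputable section

namespace WeierstrassCurve

open scoped Classical
open Filter Literature.NumberTheory.EllipticCurves
open scoped Topology

variable {p : ℕ} [Fact p.Prime] (W : WeierstrassCurve ℚ_[p]) [hW : W.IsIntegral ℤ_[p]]
  [W.IsElliptic]

section Multiples

omit [W.IsElliptic] in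
/-- `jP ∈ E₁(ℚ_p)` for `P ∈ E₁(ℚ_p)`. [Silverman AEC VII.2.2] [folklore] -/
theorem isInReductionKernel_nsmul {P : W.toAffine.Point} (hP : W.IsInReductionKernel P) (j : ℕ) :
    W.IsInReductionKernel (j • P) := by
  induction j with
  | zero => rw [zero_nsmul]; exact W.isInReductionKernel_zero
  | succ j ih => rw [succ_nsmul]; exact isInReductionKernel_add ih hP

/-- `‖z(jP)‖ ≤ ‖z(P)‖` on `E₁(ℚ_p)`. [Silverman AEC IV.3.2(a), VII.2.2] [folklore] -/
theorem norm_formalParameter_nsmul_le {P : W.toAffine.Point} (hP : W.IsInReductionKernel P)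
    (j : ℕ) : ‖W.formalParameter (j • P)‖ ≤ ‖W.formalParameter P‖ := by
  induction j with
  | zero => rw [zero_nsmul, W.formalParameter_zero, norm_zero]; exact norm_nonneg _
  | succ j ih =>
    rw [succ_nsmul]
    exact (W.norm_formalParameter_add_le (W.isInReductionKernel_nsmul hP j) hP).trans
      (max_le ih le_rfl)

/-- **`‖z(jP) - j·z(P)‖ ≤ ‖z(P)‖²`** on `E₁(ℚ_p)` (`[j](T) = jT + (deg ≥ 2)`, AEC IV.2.3, at points:
iterate `z(Q + P) = z(Q) + z(P) + O(max²)`). [Silverman AEC IV.2.3(a), VII.2.2] [folklore] -/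
theorem norm_formalParameter_nsmul_sub_le {P : W.toAffine.Point} (hP : W.IsInReductionKernel P)
    (j : ℕ) : ‖W.formalParameter (j • P) - j * W.formalParameter P‖ ≤ ‖W.formalParameter P‖ ^ 2 := by
  induction j with
  | zero =>
    rw [zero_nsmul, W.formalParameter_zero, Nat.cast_zero, zero_mul, sub_zero, norm_zero]
    exact sq_nonneg _
  | succ j ih =>
    have hjP := W.isInReductionKernel_nsmul hP j
    have h1 := W.norm_formalParameter_add_sub_sub_le hjP hP
    have hmax : max ‖W.formalParameter (j • P)‖ ‖W.formalParameter P‖ = ‖W.formalParameter P‖ :=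
      max_eq_right (W.norm_formalParameter_nsmul_le hP j)
    rw [hmax] at h1
    have hsplit : W.formalParameter ((j + 1) • P) - ((j + 1 : ℕ) : ℚ_[p]) * W.formalParameter P =
        (W.formalParameter (j • P + P) - W.formalParameter (j • P) - W.formalParameter P) +
        (W.formalParameter (j • P) - j * W.formalParameter P) := by
      rw [succ_nsmul]; push_cast; ring
    rw [hsplit]
    exact (Padic.nonarchimedean _ _).trans (max_le h1 ih)

/-- **`‖z(pP)‖ = p⁻¹‖z(P)‖` when `‖z(P)‖ < p⁻¹`** (`‖z(pP) - p z(P)‖ ≤ ‖z(P)‖² < ‖p z(P)‖`).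
[Silverman AEC IV.2.3, IV.3.2] [folklore] -/
theorem norm_formalParameter_p_nsmul {P : W.toAffine.Point} (hP : W.IsInReductionKernel P)
    (hr : ‖W.formalParameter P‖ < (p : ℝ)⁻¹) :
    ‖W.formalParameter (p • P)‖ = (p : ℝ)⁻¹ * ‖W.formalParameter P‖ := by
  have hp0 : (0 : ℝ) < p := by exact_mod_cast (Fact.out : p.Prime).pos
  by_cases hz : W.formalParameter P = 0
  · have hP0 : P = 0 := (W.formalParameter_eq_zero_iff hP).mp hz
    rw [hP0, nsmul_zero, W.formalParameter_zero, norm_zero, mul_zero]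
  have hzpos : 0 < ‖W.formalParameter P‖ := norm_pos_iff.mpr hz
  have hmain := W.norm_formalParameter_nsmul_sub_le hP p
  have hpz : ‖(p : ℚ_[p]) * W.formalParameter P‖ = (p : ℝ)⁻¹ * ‖W.formalParameter P‖ := by
    rw [norm_mul, Padic.norm_p]
  have hlt : ‖W.formalParameter (p • P) - p * W.formalParameter P‖ <
      ‖(p : ℚ_[p]) * W.formalParameter P‖ := by
    rw [hpz]
    refine hmain.trans_lt ?_
    rw [pow_two]
    exact mul_lt_mul_of_pos_right hr hzpos
  have key := Padic.add_eq_max_of_ne hlt.ne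
  rw [sub_add_cancel, max_eq_right hlt.le, hpz] at key
  exact key

/-- Iterating: `‖z(pᵏP)‖ = p⁻ᵏ‖z(P)‖` when `‖z(P)‖ < p⁻¹`. [Silverman AEC IV.3.2, IV.6.4(b)]
[folklore] -/
theorem norm_formalParameter_p_pow_nsmul {P : W.toAffine.Point} (hP : W.IsInReductionKernel P)
    (hr : ‖W.formalParameter P‖ < (p : ℝ)⁻¹) (k : ℕ) :
    ‖W.formalParameter ((p ^ k : ℕ) • P)‖ = ((p : ℝ)⁻¹) ^ k * ‖W.formalParameter P‖ := by
  induction k with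
  | zero => rw [pow_zero, one_nsmul, pow_zero, one_mul]
  | succ k ih =>
    have hpk := W.isInReductionKernel_nsmul hP (p ^ k)
    have hp1 : (p : ℝ)⁻¹ ≤ 1 := inv_le_one_of_one_le₀ (by exact_mod_cast (Fact.out : p.Prime).one_lt.le)
    have hrk : ‖W.formalParameter ((p ^ k : ℕ) • P)‖ < (p : ℝ)⁻¹ := by
      rw [ih]
      exact (mul_le_of_le_one_left (norm_nonneg _)
        (pow_le_one₀ (inv_nonneg.mpr (Nat.cast_nonneg p)) hp1)).trans_lt hr
    rw [pow_succ, mul_nsmul, W.norm_formalParameter_p_nsmul hpk hrk, ih, pow_succ]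
    ring

end Multiples

/-! ### Convergence of `z(pᵏP)/pᵏ` and the norm of `L(P)` -/

section Convergence

/-- The `k`-th approximant `a_k(P) = z(pᵏP)/pᵏ`. Consecutive differences:
`‖a_{k+1} - a_k‖ ≤ p‖z(P)‖² · p⁻ᵏ` when `‖z(P)‖ < p⁻¹`. [Silverman AEC IV.6.4(b)] [folklore] -/
theorem norm_approx_succ_sub_le {P : W.toAffine.Point} (hP : W.IsInReductionKernel P)
    (hr : ‖W.formalParameter P‖ < (p : ℝ)⁻¹) (k : ℕ) :
    ‖W.formalParameter ((p ^ (k + 1) : ℕ) • P) / (p : ℚ_[p]) ^ (k + 1) -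
        W.formalParameter ((p ^ k : ℕ) • P) / (p : ℚ_[p]) ^ k‖ ≤
      (p : ℝ) * ‖W.formalParameter P‖ ^ 2 * ((p : ℝ)⁻¹) ^ k := by
  have hp0 : (p : ℚ_[p]) ≠ 0 := Nat.cast_ne_zero.mpr (Fact.out : p.Prime).ne_zero
  have hpR : (0 : ℝ) < p := by exact_mod_cast (Fact.out : p.Prime).pos
  have hpk := W.isInReductionKernel_nsmul hP (p ^ k)
  set Q := (p ^ k : ℕ) • P with hQ
  have hstep : W.formalParameter ((p ^ (k + 1) : ℕ) • P) / (p : ℚ_[p]) ^ (k + 1) -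
      W.formalParameter Q / (p : ℚ_[p]) ^ k =
      (W.formalParameter (p • Q) - p * W.formalParameter Q) / (p : ℚ_[p]) ^ (k + 1) := by
    rw [pow_succ, mul_nsmul, ← hQ]
    field_simp
    ring
  rw [hstep, norm_div, norm_pow, Padic.norm_p]
  have hmain := W.norm_formalParameter_nsmul_sub_le hpk p
  rw [hQ, W.norm_formalParameter_p_pow_nsmul hP hr k] at hmain
  rw [div_le_iff₀ (pow_pos (inv_pos.mpr hpR) _)]
  refine hmain.trans (le_of_eq ?_)
  have hq : (p : ℝ) * (p : ℝ)⁻¹ = 1 := mul_inv_cancel₀ hpR.ne'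
  calc ((p : ℝ)⁻¹ ^ k * ‖W.formalParameter P‖) ^ 2
      = ((p : ℝ) * (p : ℝ)⁻¹) * ((p : ℝ)⁻¹ ^ k) ^ 2 * ‖W.formalParameter P‖ ^ 2 := by rw [hq]; ring
    _ = (p : ℝ) * ‖W.formalParameter P‖ ^ 2 * (p : ℝ)⁻¹ ^ k * (p : ℝ)⁻¹ ^ (k + 1) := by ring

/-- The approximants form a Cauchy sequence, hence converge; `L(P)` is the limit.
[Silverman AEC IV.6.4(b)] [folklore] -/
theorem tendsto_approx_padicLimitLog {P : W.toAffine.Point} (hP : W.IsInReductionKernel P)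
    (hr : ‖W.formalParameter P‖ < (p : ℝ)⁻¹) :
    Tendsto (fun k : ℕ => W.formalParameter ((p ^ k : ℕ) • P) / (p : ℚ_[p]) ^ k) atTop
      (𝓝 (W.padicLimitLog P)) := by
  have hp1 : (p : ℝ)⁻¹ < 1 := inv_lt_one_of_one_lt₀ (by exact_mod_cast (Fact.out : p.Prime).one_lt)
  have hC : CauchySeq fun k : ℕ => W.formalParameter ((p ^ k : ℕ) • P) / (p : ℚ_[p]) ^ k := by
    refine cauchySeq_of_le_geometric ((p : ℝ)⁻¹) ((p : ℝ) * ‖W.formalParameter P‖ ^ 2) hp1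
      fun k => ?_
    rw [dist_eq_norm, ← norm_neg, neg_sub]
    exact W.norm_approx_succ_sub_le hP hr k
  exact tendsto_nhds_limUnder (cauchySeq_tendsto_of_complete hC)

/-- All approximants stay within `p‖z(P)‖²` of `z(P)` (ultrametric telescoping).
[Silverman AEC IV.6.4(b)] [folklore] -/
theorem norm_approx_sub_formalParameter_le {P : W.toAffine.Point} (hP : W.IsInReductionKernel P)
    (hr : ‖W.formalParameter P‖ < (p : ℝ)⁻¹) (k : ℕ) :
    ‖W.formalParameter ((p ^ k : ℕ) • P) / (p : ℚ_[p]) ^ k - W.formalParameter P‖ ≤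
      (p : ℝ) * ‖W.formalParameter P‖ ^ 2 := by
  have hp1 : (p : ℝ)⁻¹ ≤ 1 := inv_le_one_of_one_le₀ (by exact_mod_cast (Fact.out : p.Prime).one_lt.le)
  have hC0 : 0 ≤ (p : ℝ) * ‖W.formalParameter P‖ ^ 2 := by positivity
  induction k with
  | zero => rw [pow_zero, one_nsmul, pow_zero, div_one, sub_self, norm_zero]; exact hC0
  | succ k ih =>
    have h1 := W.norm_approx_succ_sub_le hP hr k
    have h1' : ‖W.formalParameter ((p ^ (k + 1) : ℕ) • P) / (p : ℚ_[p]) ^ (k + 1) -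
        W.formalParameter ((p ^ k : ℕ) • P) / (p : ℚ_[p]) ^ k‖ ≤ (p : ℝ) * ‖W.formalParameter P‖ ^ 2 :=
      h1.trans (mul_le_of_le_one_right hC0 (pow_le_one₀ (inv_nonneg.mpr (Nat.cast_nonneg p)) hp1))
    have hsplit : W.formalParameter ((p ^ (k + 1) : ℕ) • P) / (p : ℚ_[p]) ^ (k + 1) - W.formalParameter P =
        (W.formalParameter ((p ^ (k + 1) : ℕ) • P) / (p : ℚ_[p]) ^ (k + 1) -
          W.formalParameter ((p ^ k : ℕ) • P) / (p : ℚ_[p]) ^ k) +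
        (W.formalParameter ((p ^ k : ℕ) • P) / (p : ℚ_[p]) ^ k - W.formalParameter P) := by ring
    rw [hsplit]
    exact (Padic.nonarchimedean _ _).trans (max_le h1' ih)

/-- **`‖L(P) - z(P)‖ ≤ p‖z(P)‖²`** for `‖z(P)‖ < p⁻¹`. [Silverman AEC IV.6.4(b)
(`log` is `z + O(z²)` and preserves valuations on `𝓜ʳ`)] [folklore] -/
theorem norm_padicLimitLog_sub_formalParameter_le {P : W.toAffine.Point}
    (hP : W.IsInReductionKernel P) (hr : ‖W.formalParameter P‖ < (p : ℝ)⁻¹) :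
    ‖W.padicLimitLog P - W.formalParameter P‖ ≤ (p : ℝ) * ‖W.formalParameter P‖ ^ 2 := by
  have ht := W.tendsto_approx_padicLimitLog hP hr
  have ht' : Tendsto (fun k : ℕ => ‖W.formalParameter ((p ^ k : ℕ) • P) / (p : ℚ_[p]) ^ k -
      W.formalParameter P‖) atTop (𝓝 ‖W.padicLimitLog P - W.formalParameter P‖) :=
    (ht.sub_const _).norm
  exact le_of_tendsto' ht' fun k => W.norm_approx_sub_formalParameter_le hP hr k

/-- **`‖L(P)‖ = ‖z(P)‖`** for `‖z(P)‖ < p⁻¹` (then `p‖z(P)‖² < ‖z(P)‖`). [Silverman AEC IV.6.4(b)]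
[folklore] -/
theorem norm_padicLimitLog {P : W.toAffine.Point} (hP : W.IsInReductionKernel P)
    (hr : ‖W.formalParameter P‖ < (p : ℝ)⁻¹) : ‖W.padicLimitLog P‖ = ‖W.formalParameter P‖ := by
  have hpR : (0 : ℝ) < p := by exact_mod_cast (Fact.out : p.Prime).pos
  by_cases hz : W.formalParameter P = 0
  · have hP0 : P = 0 := (W.formalParameter_eq_zero_iff hP).mp hz
    rw [hP0, W.padicLimitLog_zero, W.formalParameter_zero]
  have hzpos : 0 < ‖W.formalParameter P‖ := norm_pos_iff.mpr hz
  have hle := W.norm_padicLimitLog_sub_formalParameter_le hP hr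
  have hlt : ‖W.padicLimitLog P - W.formalParameter P‖ < ‖W.formalParameter P‖ := by
    refine hle.trans_lt ?_
    calc (p : ℝ) * ‖W.formalParameter P‖ ^ 2 = ((p : ℝ) * ‖W.formalParameter P‖) *
        ‖W.formalParameter P‖ := by ring
      _ < 1 * ‖W.formalParameter P‖ := by
          refine mul_lt_mul_of_pos_right ?_ hzpos
          calc (p : ℝ) * ‖W.formalParameter P‖ < (p : ℝ) * (p : ℝ)⁻¹ := mul_lt_mul_of_pos_left hr hpR
            _ = 1 := mul_inv_cancel₀ hpR.ne'
      _ = ‖W.formalParameter P‖ := one_mul _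
  have := Padic.add_eq_max_of_ne hlt.ne
  rw [sub_add_cancel, max_eq_right hlt.le] at this
  exact this

end Convergence

/-! ### Additivity of `L` -/

section Additive

/-- **`L(P + Q) = L(P) + L(Q)`** for `P, Q ∈ E₁(ℚ_p)` with `‖z(P)‖, ‖z(Q)‖ < p⁻¹`: in the group,
`pᵏ(P + Q) = pᵏP + pᵏQ`, and `‖z(pᵏP + pᵏQ) - z(pᵏP) - z(pᵏQ)‖ ≤ max² = O(p⁻²ᵏ)`, which divided by
`‖pᵏ‖ = p⁻ᵏ` still tends to `0`. [Silverman AEC IV.6.4, VII.6.3 (the homomorphism onto `R⁺`)]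
[cite: SilvermanAEC2009, VII.6.3] -/
theorem padicLimitLog_add {P Q : W.toAffine.Point} (hP : W.IsInReductionKernel P)
    (hQ : W.IsInReductionKernel Q) (hrP : ‖W.formalParameter P‖ < (p : ℝ)⁻¹)
    (hrQ : ‖W.formalParameter Q‖ < (p : ℝ)⁻¹) :
    W.padicLimitLog (P + Q) = W.padicLimitLog P + W.padicLimitLog Q := by
  have hpR : (0 : ℝ) < p := by exact_mod_cast (Fact.out : p.Prime).pos
  have hp1 : (p : ℝ)⁻¹ < 1 := inv_lt_one_of_one_lt₀ (by exact_mod_cast (Fact.out : p.Prime).one_lt)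
  have htP := W.tendsto_approx_padicLimitLog hP hrP
  have htQ := W.tendsto_approx_padicLimitLog hQ hrQ
  -- the error term
  set r := max ‖W.formalParameter P‖ ‖W.formalParameter Q‖ with hrdef
  have herr : ∀ k : ℕ, ‖W.formalParameter ((p ^ k : ℕ) • (P + Q)) / (p : ℚ_[p]) ^ k -
      W.formalParameter ((p ^ k : ℕ) • P) / (p : ℚ_[p]) ^ k -
      W.formalParameter ((p ^ k : ℕ) • Q) / (p : ℚ_[p]) ^ k‖ ≤ r ^ 2 * ((p : ℝ)⁻¹) ^ k := by
    intro k
    have hpkP := W.isInReductionKernel_nsmul hP (p ^ k)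
    have hpkQ := W.isInReductionKernel_nsmul hQ (p ^ k)
    have h := W.norm_formalParameter_add_sub_sub_le hpkP hpkQ
    rw [W.norm_formalParameter_p_pow_nsmul hP hrP k, W.norm_formalParameter_p_pow_nsmul hQ hrQ k,
      ← mul_max_of_nonneg _ _ (pow_nonneg (inv_nonneg.mpr (Nat.cast_nonneg p)) k), ← hrdef] at h
    have hsplit : W.formalParameter ((p ^ k : ℕ) • (P + Q)) / (p : ℚ_[p]) ^ k -
        W.formalParameter ((p ^ k : ℕ) • P) / (p : ℚ_[p]) ^ k -
        W.formalParameter ((p ^ k : ℕ) • Q) / (p : ℚ_[p]) ^ k =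
        (W.formalParameter ((p ^ k : ℕ) • P + (p ^ k : ℕ) • Q) -
          W.formalParameter ((p ^ k : ℕ) • P) - W.formalParameter ((p ^ k : ℕ) • Q)) /
        (p : ℚ_[p]) ^ k := by
      rw [nsmul_add]; ring
    rw [hsplit, norm_div, norm_pow, Padic.norm_p, div_le_iff₀ (pow_pos (inv_pos.mpr hpR) _)]
    refine h.trans (le_of_eq ?_)
    ring
  have herr0 : Tendsto (fun k : ℕ => W.formalParameter ((p ^ k : ℕ) • (P + Q)) / (p : ℚ_[p]) ^ k -
      W.formalParameter ((p ^ k : ℕ) • P) / (p : ℚ_[p]) ^ k -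
      W.formalParameter ((p ^ k : ℕ) • Q) / (p : ℚ_[p]) ^ k) atTop (𝓝 0) := by
    rw [tendsto_zero_iff_norm_tendsto_zero]
    have hg : Tendsto (fun k : ℕ => r ^ 2 * ((p : ℝ)⁻¹) ^ k) atTop (𝓝 0) := by
      have := (tendsto_pow_atTop_nhds_zero_of_lt_one (inv_nonneg.mpr (Nat.cast_nonneg p)) hp1).const_mul
        (r ^ 2)
      rwa [mul_zero] at this
    exact squeeze_zero (fun k => norm_nonneg _) herr hg
  have hsum := (herr0.add htP).add htQ
  rw [zero_add] at hsum
  have hsum' : Tendsto (fun k : ℕ => W.formalParameter ((p ^ k : ℕ) • (P + Q)) / (p : ℚ_[p]) ^ k)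
      atTop (𝓝 (W.padicLimitLog P + W.padicLimitLog Q)) :=
    hsum.congr fun k => by ring
  exact hsum'.limUnder_eq

/-- `L(-P) = -L(P)` (same hypotheses). [Silverman AEC VII.6.3] [folklore] -/
theorem padicLimitLog_neg {P : W.toAffine.Point} (hP : W.IsInReductionKernel P)
    (hrP : ‖W.formalParameter P‖ < (p : ℝ)⁻¹) : W.padicLimitLog (-P) = -W.padicLimitLog P := by
  have hnP := W.isInReductionKernel_neg hP
  have hrn : ‖W.formalParameter (-P)‖ < (p : ℝ)⁻¹ := by rwa [W.norm_formalParameter_neg hP]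
  have h := W.padicLimitLog_add hP hnP hrP hrn
  rw [add_neg_cancel, W.padicLimitLog_zero] at h
  linear_combination -h

end Additive

/-! ### `L` on the level subgroups `E⁽ⁿ⁾`, `n ≥ 2` -/

section Level

variable {W}

/-- On `E⁽ⁿ⁾` with `n ≥ 2` the standing hypothesis `‖z(P)‖ < p⁻¹` holds. [folklore] -/
theorem norm_formalParameter_lt_inv_of_mem {n : ℕ} (hn : 2 ≤ n) {P : W.toAffine.Point}
    (hP : P ∈ W.formalFiltration n) : ‖W.formalParameter P‖ < (p : ℝ)⁻¹ := by
  have hp1 : (p : ℝ)⁻¹ < 1 := inv_lt_one_of_one_lt₀ (by exact_mod_cast (Fact.out : p.Prime).one_lt)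
  have hp0 : 0 < (p : ℝ)⁻¹ := inv_pos.mpr (by exact_mod_cast (Fact.out : p.Prime).pos)
  refine hP.2.trans_lt ?_
  calc ((p : ℝ)⁻¹) ^ n ≤ ((p : ℝ)⁻¹) ^ 2 := pow_le_pow_of_le_one hp0.le hp1.le hn
    _ < (p : ℝ)⁻¹ := by rw [pow_two]; exact mul_lt_of_lt_one_right hp0 hp1

variable (W)

/-- **`L` restricted to `E⁽ⁿ⁾(ℚ_p)` (`n ≥ 2`) is an additive homomorphism to `ℚ_p`.**
[Silverman AEC VII.6.3] [cite: SilvermanAEC2009, VII.6.3] -/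
theorem padicLimitLog_add_of_mem {n : ℕ} (hn : 2 ≤ n) {P Q : W.toAffine.Point}
    (hP : P ∈ W.formalFiltration n) (hQ : Q ∈ W.formalFiltration n) :
    W.padicLimitLog (P + Q) = W.padicLimitLog P + W.padicLimitLog Q :=
  W.padicLimitLog_add hP.1 hQ.1 (norm_formalParameter_lt_inv_of_mem hn hP)
    (norm_formalParameter_lt_inv_of_mem hn hQ)

/-- `‖L(P)‖ = ‖z(P)‖ ≤ p⁻ⁿ` on `E⁽ⁿ⁾`, `n ≥ 2`. [Silverman AEC IV.6.4(b)] [folklore] -/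
theorem norm_padicLimitLog_of_mem {n : ℕ} (hn : 2 ≤ n) {P : W.toAffine.Point}
    (hP : P ∈ W.formalFiltration n) : ‖W.padicLimitLog P‖ = ‖W.formalParameter P‖ :=
  W.norm_padicLimitLog hP.1 (norm_formalParameter_lt_inv_of_mem hn hP)

/-- **Injectivity**: `L(P) = 0 ⇒ P = O` on `E⁽ⁿ⁾`, `n ≥ 2`. [Silverman AEC IV.6.4(b)] [folklore] -/
theorem eq_zero_of_padicLimitLog_eq_zero {n : ℕ} (hn : 2 ≤ n) {P : W.toAffine.Point}
    (hP : P ∈ W.formalFiltration n) (h0 : W.padicLimitLog P = 0) : P = 0 := by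
  have h := W.norm_padicLimitLog_of_mem hn hP
  rw [h0, norm_zero] at h
  exact (W.formalParameter_eq_zero_iff hP.1).mp (norm_eq_zero.mp h.symm)

end Level

end WeierstrassCurve

namespace WeierstrassCurve

open scoped Classical
open Filter Literature.NumberTheory.EllipticCurves
open scoped Topology

variable {p : ℕ} [Fact p.Prime] (W : WeierstrassCurve ℚ_[p]) [hW : W.IsIntegral ℤ_[p]]
  [W.IsElliptic]

/-! ### Lipschitz control of the parameter under translation and difference -/

section Lipschitz

/-- **`‖z(Q + P) - z(Q)‖ ≤ ‖z(P)‖`** on `E₁(ℚ_p)`: `z(Q + P) = F(z(P), z(Q))`, `z(Q) = F(0, z(Q))`,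
and `F` is `1`-Lipschitz in its first variable. [Silverman AEC IV.1, VII.2.2] [folklore] -/
theorem norm_formalParameter_add_sub_le {P Q : W.toAffine.Point} (hP : W.IsInReductionKernel P)
    (hQ : W.IsInReductionKernel Q) :
    ‖W.formalParameter (Q + P) - W.formalParameter Q‖ ≤ ‖W.formalParameter P‖ := by
  have hu := W.norm_formalParameter_lt_one hP
  have hv := W.norm_formalParameter_lt_one hQ
  have h0 : ‖(0 : ℚ_[p])‖ < 1 := by rw [norm_zero]; exact one_pos
  have h1 : W.formalParameter (Q + P) =
      padicEval₂ W.formalGroupLaw (W.formalParameter P) (W.formalParameter Q) := by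
    rw [add_comm]; exact (formalGroupLaw_padicEval_holds p W P Q hP hQ).symm
  have h2 : padicEval₂ W.formalGroupLaw 0 (W.formalParameter Q) = W.formalParameter Q := by
    have := formalGroupLaw_padicEval_holds p W 0 Q W.isInReductionKernel_zero hQ
    rwa [zero_add, W.formalParameter_zero] at this
  calc ‖W.formalParameter (Q + P) - W.formalParameter Q‖
      = ‖padicEval₂ W.formalGroupLaw (W.formalParameter P) (W.formalParameter Q) -
          padicEval₂ W.formalGroupLaw 0 (W.formalParameter Q)‖ := by rw [h2, h1]
    _ ≤ ‖W.formalParameter P - 0‖ :=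
        norm_padicEval₂_sub_padicEval₂_le W.isPadicInt_formalGroupLaw hu h0 hv
    _ = ‖W.formalParameter P‖ := by rw [sub_zero]

/-- **`‖z(P - Q)‖ ≤ ‖z(P) - z(Q)‖`** on `E₁(ℚ_p)`: `z(P - Q) = F(z(P), z(-Q))`,
`0 = z(Q - Q) = F(z(Q), z(-Q))`, and `F` is `1`-Lipschitz in its first variable.
[Silverman AEC IV.1, VII.2.2] [folklore] -/
theorem norm_formalParameter_sub_le {P Q : W.toAffine.Point} (hP : W.IsInReductionKernel P)
    (hQ : W.IsInReductionKernel Q) :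
    ‖W.formalParameter (P - Q)‖ ≤ ‖W.formalParameter P - W.formalParameter Q‖ := by
  have hnQ := W.isInReductionKernel_neg hQ
  have hu := W.norm_formalParameter_lt_one hP
  have hv := W.norm_formalParameter_lt_one hQ
  have hc := W.norm_formalParameter_lt_one hnQ
  have h1 : W.formalParameter (P - Q) =
      padicEval₂ W.formalGroupLaw (W.formalParameter P) (W.formalParameter (-Q)) := by
    rw [sub_eq_add_neg]; exact (formalGroupLaw_padicEval_holds p W P (-Q) hP hnQ).symm
  have h2 : padicEval₂ W.formalGroupLaw (W.formalParameter Q) (W.formalParameter (-Q)) = 0 := by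
    have := formalGroupLaw_padicEval_holds p W Q (-Q) hQ hnQ
    rwa [add_neg_cancel, W.formalParameter_zero] at this
  calc ‖W.formalParameter (P - Q)‖
      = ‖padicEval₂ W.formalGroupLaw (W.formalParameter P) (W.formalParameter (-Q)) -
          padicEval₂ W.formalGroupLaw (W.formalParameter Q) (W.formalParameter (-Q))‖ := by
        rw [h2, h1, sub_zero]
    _ ≤ ‖W.formalParameter P - W.formalParameter Q‖ :=
        norm_padicEval₂_sub_padicEval₂_le W.isPadicInt_formalGroupLaw hu hv hc

end Lipschitz

/-! ### Surjectivity of `L : E⁽ⁿ⁾(ℚ_p) → pⁿℤ_p` (`n ≥ 2`) and the isomorphism with `ℤ_p` -/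

section Surjective

/-- `L(-P) = -L(P)` on `E⁽ⁿ⁾`, `n ≥ 2`. [Silverman AEC VII.6.3] [folklore] -/
theorem padicLimitLog_neg_of_mem {n : ℕ} (hn : 2 ≤ n) {P : W.toAffine.Point}
    (hP : P ∈ W.formalFiltration n) : W.padicLimitLog (-P) = -W.padicLimitLog P :=
  W.padicLimitLog_neg hP.1 (norm_formalParameter_lt_inv_of_mem hn hP)

/-- `L(P - Q) = L(P) - L(Q)` on `E⁽ⁿ⁾`, `n ≥ 2`. [Silverman AEC VII.6.3] [folklore] -/
theorem padicLimitLog_sub_of_mem {n : ℕ} (hn : 2 ≤ n) {P Q : W.toAffine.Point}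
    (hP : P ∈ W.formalFiltration n) (hQ : Q ∈ W.formalFiltration n) :
    W.padicLimitLog (P - Q) = W.padicLimitLog P - W.padicLimitLog Q := by
  rw [sub_eq_add_neg, W.padicLimitLog_add_of_mem hn hP (neg_mem hQ), W.padicLimitLog_neg_of_mem hn hQ,
    sub_eq_add_neg]

/-- **Surjectivity of `L : E⁽ⁿ⁾(ℚ_p) → pⁿℤ_p` for `n ≥ 2`** by successive approximation: for
`‖s‖ ≤ p⁻ⁿ` the point `P_s` with `z(P_s) = s` (inverse dictionary) has `‖s - L(P_s)‖ ≤ p‖s‖² ≤ p⁻¹‖s‖`;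
iterating `t_{k+1} = t_k - L(P_{t_k})` from `t₀ = t` and summing the points gives `Q_k` with
`L(Q_k) = t - t_k → t`; the parameters `z(Q_k)` form a Cauchy sequence (translation is
`1`-Lipschitz in the parameter), whose limit `s_∞` yields `Q_∞ = P_{s_∞}` with `L(Q_∞) = t`
(`L(Q_k) → L(Q_∞)` because `‖L(Q_∞ - Q_k)‖ = ‖z(Q_∞ - Q_k)‖ ≤ ‖z(Q_∞) - z(Q_k)‖`).
[Silverman AEC IV.6.4(b) (`log : Ê(𝓜ʳ) → 𝓜ʳ` is an isomorphism), VII.6.3]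
[cite: SilvermanAEC2009, VII.6.3] -/
theorem exists_mem_padicLimitLog_eq {n : ℕ} (hn : 2 ≤ n) {t : ℚ_[p]}
    (ht : ‖t‖ ≤ ((p : ℝ)⁻¹) ^ n) :
    ∃ Q ∈ W.formalFiltration n, W.padicLimitLog Q = t := by
  have hpR : (0 : ℝ) < p := by exact_mod_cast (Fact.out : p.Prime).pos
  have hp1 : (p : ℝ)⁻¹ < 1 := inv_lt_one_of_one_lt₀ (by exact_mod_cast (Fact.out : p.Prime).one_lt)
  have hp0' : (0 : ℝ) ≤ (p : ℝ)⁻¹ := inv_nonneg.mpr hpR.le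
  have hρ1 : ((p : ℝ)⁻¹) ^ n < 1 := pow_lt_one₀ hp0' hp1 (by omega)
  have hpow1 : ∀ k : ℕ, ((p : ℝ)⁻¹) ^ k ≤ 1 := fun k => pow_le_one₀ hp0' hp1.le
  -- a choice of points with prescribed parameter (inverse dictionary)
  have hex : ∀ s : ℚ_[p], ∃ P : W.toAffine.Point,
      ‖s‖ < 1 → W.IsInReductionKernel P ∧ W.formalParameter P = s := by
    intro s
    by_cases hs : ‖s‖ < 1
    · obtain ⟨P, hP, hPs⟩ := W.exists_isInReductionKernel_formalParameter_eq hs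
      exact ⟨P, fun _ => ⟨hP, hPs⟩⟩
    · exact ⟨0, fun h => absurd h hs⟩
  choose pt hpt using hex
  have hmem : ∀ s : ℚ_[p], ‖s‖ ≤ ((p : ℝ)⁻¹) ^ n → pt s ∈ W.formalFiltration n := fun s hs =>
    ⟨(hpt s (hs.trans_lt hρ1)).1, by rw [(hpt s (hs.trans_lt hρ1)).2]; exact hs⟩
  -- the defect of one step
  have hdef : ∀ s : ℚ_[p], ‖s‖ ≤ ((p : ℝ)⁻¹) ^ n →
      ‖s - W.padicLimitLog (pt s)‖ ≤ (p : ℝ)⁻¹ * ‖s‖ := by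
    intro s hs
    obtain ⟨hE, hz⟩ := hpt s (hs.trans_lt hρ1)
    have hlt : ‖W.formalParameter (pt s)‖ < (p : ℝ)⁻¹ :=
      norm_formalParameter_lt_inv_of_mem hn (hmem s hs)
    have h := W.norm_padicLimitLog_sub_formalParameter_le hE hlt
    rw [hz] at h
    rw [← norm_neg, neg_sub]
    refine h.trans ?_
    have hs2 : ‖s‖ ≤ ((p : ℝ)⁻¹) ^ 2 := hs.trans (pow_le_pow_of_le_one hp0' hp1.le hn)
    calc (p : ℝ) * ‖s‖ ^ 2 = ((p : ℝ) * ‖s‖) * ‖s‖ := by ring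
      _ ≤ ((p : ℝ) * ((p : ℝ)⁻¹) ^ 2) * ‖s‖ := by gcongr
      _ = (p : ℝ)⁻¹ * ‖s‖ := by rw [pow_two, ← mul_assoc, mul_inv_cancel₀ hpR.ne', one_mul]
  -- the residual targets `t_k`
  let T : ℕ → ℚ_[p] := fun k => Nat.rec t (fun _ s => s - W.padicLimitLog (pt s)) k
  have hT0 : T 0 = t := rfl
  have hTsucc : ∀ k, T (k + 1) = T k - W.padicLimitLog (pt (T k)) := fun k => rfl
  have hTnorm : ∀ k, ‖T k‖ ≤ ((p : ℝ)⁻¹) ^ n * ((p : ℝ)⁻¹) ^ k := by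
    intro k
    induction k with
    | zero => rw [hT0, pow_zero, mul_one]; exact ht
    | succ k ih =>
      have hk : ‖T k‖ ≤ ((p : ℝ)⁻¹) ^ n :=
        ih.trans (mul_le_of_le_one_right (pow_nonneg hp0' n) (hpow1 k))
      rw [hTsucc]
      calc ‖T k - W.padicLimitLog (pt (T k))‖ ≤ (p : ℝ)⁻¹ * ‖T k‖ := hdef _ hk
        _ ≤ (p : ℝ)⁻¹ * (((p : ℝ)⁻¹) ^ n * ((p : ℝ)⁻¹) ^ k) := by gcongr
        _ = ((p : ℝ)⁻¹) ^ n * ((p : ℝ)⁻¹) ^ (k + 1) := by ring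
  have hTle : ∀ k, ‖T k‖ ≤ ((p : ℝ)⁻¹) ^ n := fun k =>
    (hTnorm k).trans (mul_le_of_le_one_right (pow_nonneg hp0' n) (hpow1 k))
  -- partial sums of the points
  let Qs : ℕ → W.toAffine.Point := fun k => ∑ j ∈ Finset.range k, pt (T j)
  have hQs0 : Qs 0 = 0 := Finset.sum_range_zero _
  have hQsucc : ∀ k, Qs (k + 1) = Qs k + pt (T k) := fun k => Finset.sum_range_succ _ _
  have hQmem : ∀ k, Qs k ∈ W.formalFiltration n := fun k =>
    sum_mem fun j _ => hmem _ (hTle j)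
  have hLQ : ∀ k, W.padicLimitLog (Qs k) = t - T k := by
    intro k
    induction k with
    | zero => rw [hQs0, W.padicLimitLog_zero, hT0, sub_self]
    | succ k ih =>
      rw [hQsucc, W.padicLimitLog_add_of_mem hn (hQmem k) (hmem _ (hTle k)), ih, hTsucc]; ring
  -- `z(Q_k)` is Cauchy
  have hzQ : ∀ k, dist (W.formalParameter (Qs k)) (W.formalParameter (Qs (k + 1))) ≤
      ((p : ℝ)⁻¹) ^ n * ((p : ℝ)⁻¹) ^ k := by
    intro k
    rw [dist_comm, dist_eq_norm, hQsucc]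
    have hE := (hpt (T k) ((hTle k).trans_lt hρ1))
    calc ‖W.formalParameter (Qs k + pt (T k)) - W.formalParameter (Qs k)‖
        ≤ ‖W.formalParameter (pt (T k))‖ := W.norm_formalParameter_add_sub_le hE.1 (hQmem k).1
      _ = ‖T k‖ := by rw [hE.2]
      _ ≤ _ := hTnorm k
  have hC : CauchySeq fun k => W.formalParameter (Qs k) :=
    cauchySeq_of_le_geometric _ _ hp1 hzQ
  obtain ⟨s, hs⟩ := cauchySeq_tendsto_of_complete hC
  have hsle : ‖s‖ ≤ ((p : ℝ)⁻¹) ^ n := le_of_tendsto' hs.norm fun k => (hQmem k).2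
  refine ⟨pt s, hmem s hsle, ?_⟩
  -- `L(Q_k) → t`
  have hlim1 : Tendsto (fun k => W.padicLimitLog (Qs k)) atTop (𝓝 t) := by
    have hT0' : Tendsto T atTop (𝓝 0) := by
      rw [tendsto_zero_iff_norm_tendsto_zero]
      have hg : Tendsto (fun k : ℕ => ((p : ℝ)⁻¹) ^ n * ((p : ℝ)⁻¹) ^ k) atTop (𝓝 0) := by
        have := (tendsto_pow_atTop_nhds_zero_of_lt_one hp0' hp1).const_mul (((p : ℝ)⁻¹) ^ n)
        rwa [mul_zero] at this
      exact squeeze_zero (fun k => norm_nonneg _) hTnorm hg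
    have h := (tendsto_const_nhds (x := t)).sub hT0'
    rw [sub_zero] at h
    exact h.congr fun k => (hLQ k).symm
  -- `L(Q_k) → L(Q_∞)`
  have hlim2 : Tendsto (fun k => W.padicLimitLog (Qs k)) atTop (𝓝 (W.padicLimitLog (pt s))) := by
    rw [tendsto_iff_norm_sub_tendsto_zero]
    have hbound : ∀ k, ‖W.padicLimitLog (Qs k) - W.padicLimitLog (pt s)‖ ≤
        ‖W.formalParameter (Qs k) - s‖ := by
      intro k
      have hmemd : Qs k - pt s ∈ W.formalFiltration n := sub_mem (hQmem k) (hmem s hsle)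
      rw [← W.padicLimitLog_sub_of_mem hn (hQmem k) (hmem s hsle),
        W.norm_padicLimitLog_of_mem hn hmemd]
      calc ‖W.formalParameter (Qs k - pt s)‖
          ≤ ‖W.formalParameter (Qs k) - W.formalParameter (pt s)‖ :=
            W.norm_formalParameter_sub_le (hQmem k).1 (hmem s hsle).1
        _ = ‖W.formalParameter (Qs k) - s‖ := by rw [(hpt s (hsle.trans_lt hρ1)).2]
    exact squeeze_zero (fun k => norm_nonneg _) hbound (tendsto_iff_norm_sub_tendsto_zero.mp hs)
  exact tendsto_nhds_unique hlim2 hlim1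

/-- **`E⁽ⁿ⁾(ℚ_p) ≃+ ℤ_p` for `n ≥ 2` (all `p`)** via `P ↦ L(P)/pⁿ`: additive (`padicLimitLog_add`),
injective (`‖L(P)‖ = ‖z(P)‖`), surjective (`exists_mem_padicLimitLog_eq`). This is Silverman
AEC IV.6.4(b) (`Ê(𝓜ʳ) ≅ 𝓜ʳ ≅ R⁺` for `r > v(p)/(p-1)`) transported to `E₁(ℚ_p)` by VII.2.2, with
the limit logarithm in place of `log_Ê`. [cite: SilvermanAEC2009, VII.6.3] -/
theorem nonempty_formalFiltration_addEquiv_padicInt {n : ℕ} (hn : 2 ≤ n) :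
    Nonempty (W.formalFiltration n ≃+ ℤ_[p]) := by
  have hp0 : (p : ℚ_[p]) ≠ 0 := Nat.cast_ne_zero.mpr (Fact.out : p.Prime).ne_zero
  have hpn : (p : ℚ_[p]) ^ n ≠ 0 := pow_ne_zero _ hp0
  have hpR : (0 : ℝ) < p := by exact_mod_cast (Fact.out : p.Prime).pos
  have hnorm : ∀ P : W.formalFiltration n, ‖W.padicLimitLog P / (p : ℚ_[p]) ^ n‖ ≤ 1 := by
    intro P
    rw [norm_div, Padic.norm_p_pow, W.norm_padicLimitLog_of_mem hn P.2, zpow_neg, zpow_natCast,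
      ← inv_pow, div_le_one (pow_pos (inv_pos.mpr hpR) _)]
    exact P.2.2
  let φ : W.formalFiltration n →+ ℤ_[p] :=
    { toFun := fun P => ⟨W.padicLimitLog P / (p : ℚ_[p]) ^ n, hnorm P⟩
      map_zero' := by
        apply PadicInt.ext
        show W.padicLimitLog (0 : W.toAffine.Point) / (p : ℚ_[p]) ^ n = 0
        rw [W.padicLimitLog_zero, zero_div]
      map_add' := fun P Q => by
        apply PadicInt.ext
        show W.padicLimitLog ((P : W.toAffine.Point) + Q) / (p : ℚ_[p]) ^ n =
          W.padicLimitLog (P : W.toAffine.Point) / (p : ℚ_[p]) ^ n +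
            W.padicLimitLog (Q : W.toAffine.Point) / (p : ℚ_[p]) ^ n
        rw [W.padicLimitLog_add_of_mem hn P.2 Q.2, add_div] }
  have hφ : ∀ P : W.formalFiltration n, (φ P : ℚ_[p]) = W.padicLimitLog P / (p : ℚ_[p]) ^ n :=
    fun P => rfl
  refine ⟨AddEquiv.ofBijective φ ⟨?_, ?_⟩⟩
  · rw [injective_iff_map_eq_zero]
    intro P hP0
    have h1 : W.padicLimitLog P / (p : ℚ_[p]) ^ n = 0 := by
      rw [← hφ P, hP0]; rfl
    have h2 : W.padicLimitLog P = 0 := by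
      rcases div_eq_zero_iff.mp h1 with h | h
      · exact h
      · exact absurd h hpn
    exact Subtype.ext (W.eq_zero_of_padicLimitLog_eq_zero hn P.2 h2)
  · intro w
    have ht : ‖(p : ℚ_[p]) ^ n * w‖ ≤ ((p : ℝ)⁻¹) ^ n := by
      rw [norm_mul, Padic.norm_p_pow, zpow_neg, zpow_natCast, ← inv_pow]
      exact mul_le_of_le_one_right (pow_nonneg (inv_nonneg.mpr hpR.le) _) (PadicInt.norm_le_one w)
    obtain ⟨Q, hQ, hL⟩ := W.exists_mem_padicLimitLog_eq hn ht
    refine ⟨⟨Q, hQ⟩, PadicInt.ext ?_⟩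
    rw [hφ]
    show W.padicLimitLog Q / (p : ℚ_[p]) ^ n = w
    rw [hL, mul_div_cancel_left₀ _ hpn]

end Surjective

end WeierstrassCurve
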